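import Summits.BirchSwinnertonDyer.BirchSwinnertonDyer.Theorems.ThetaPartnerAtTwoSignedControlAtTwoReduce
import Summits.BirchSwinnertonDyer.BirchSwinnertonDyer.Theorems.ThetaPartnerAtTwoSignedKatoUpToAtTwoOfColemanKato
import Summits.BirchSwinnertonDyer.BirchSwinnertonDyer.Theorems.ThetaPartnerAtTwoAssembly
import Literature.NumberTheory.EllipticCurves.AnalyticRankModularityProofs
import Literature.NumberTheory.EllipticCurves.ModularParametrizationBCDTProofs
import HarnessLib

/-!
# Route `ByReductionTypeAtTwo` (rung K4), crux `SupersingularRankZeroAtTwo` (item stmt-BirchSwinnertonDyer-19097)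
# ON THE THETA HABITAT: BSD₂ from the CM-PARTNER TRANSPORT road of route `ThetaPartnerAtTwo` (TP2) fed with
# 19097's own registered stubs (1) (1′) (2′) (4) — the HARDEST stub (3) `stub_zeroKobayashiLower` (Eisenstein half)
# and the CONJECTURE stub (4′) `stub_zeroMuPlusOfNonSurj` (`μ⁺ = 0`) are NOT used on the habitat
# (seat `bsd-2adic-ss-1x`, the WIDTH-LEVER second prover lane on 19097; cross-route memo CROSS-ROUTE-TP2-K3K4-v1, RC-138)

HONEST FRAMING (cell `bsd-2adic`, run/shared/lean/pub/bsd-2adic/, HUMAN RULINGS D-0036/D-0054/D-0074): THEOREMS ONLY —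
no definition, no named fact, no instance, no `sorry`; every research input stays a displayed binder; closes no item
by itself; nothing booked; BSD is NOT proved by any of this. PARTITION (D-0054): X5@2 good-SUPERSINGULAR, `a₂ = 0`
THETA-HABITAT sub-row (B1·O1; the theta habitat of TP2 = the non-CM, analytic-rank-`0`, good-supersingular-at-`2`,
`a₂ = 0` curves `2`-congruent to a rank-`0` CM curve good supersingular at `2` with `a₂ = 0`; inside the census
block `N < 5·10⁵` it is 19 of the 208 `a₂ = 0` rank-`0` classes, HABITAT-CENSUS-TP2-v1.md) × `p = 2` —
types-the-object-of (19097 on the habitat); bears_on: K4-leaf crux 19097 · TP2 K1 20333 / K2r0 20312 / K3 20308 /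
K4 20309 · W-ALL row 1 slice leaf `WAllNonCMAtTwoThetaHabitat`.

## The road (θ-element / Mazur–Tate = CM-partner transport at `2`), and what this file proves

TP2's deciding theorem `Theses.ThetaPartnerAtTwo.closes` turns {modularity, entire `L`, GZK, K1 `SignedTransportAtTwo`,
K2r0 `SignedMainConjectureCMTwoRankZero`, K3 `SignedKatoDivisibilityUpToAtTwo`, K4 `SignedControlAtTwo`} into the slice
leaf `WAllNonCMAtTwoThetaHabitat` = «BSD₂ for every habitat curve». The two sibling files of this seat show K3 ⟸ 19097's
stubs (1′) `stub_katoPub` + (4) `stub_zeroColemanKato` (`ThetaPartnerXRoute.signedKatoDivisibilityUpToAtTwo_of_zeroColemanKato`)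
and K4 ⟸ 19097's stub (2′) `stub_zeroSignedEulerChar` (`ThetaPartnerXRoute.signedControlAtTwo_of_signedEulerCharAtTwo`);
entire continuation ⟸ modularity (`hasEntireLFunction_rat_of_exists_isNewformOf` ∘
`exists_isNewformOf_of_nonempty_modularParametrizationData`, BCDT (6) ⇒ (2) ⇒ Version `L`). Hence:

* `thetaHabitat_of_thetaPartnerItems` — TP2's `closes` with the `EntireLFunctionRat` binder discharged from modularity.
* `thetaHabitat_of_signedTransport_of_stubs` — **the slice leaf `WAllNonCMAtTwoThetaHabitat` (= crux 19097 restricted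
  to the theta habitat) from 19097's registered stubs (1) `stub_ssPub`, (1′) `stub_katoPub`, (2′) `stub_zeroSignedEulerChar`,
  (4) `stub_zeroColemanKato` (their v8/v9 signatures VERBATIM) plus TP2's K1 `SignedTransportAtTwo` (item 20333) and K2r0
  `SignedMainConjectureCMTwoRankZero` (item 20312) BY NAME.** On the habitat the Eisenstein half (stub (3), MATH-BOUND,
  HARDEST) and `μ⁺ = 0` (stub (4′), CONJECTURE on the 2 non-surjective classes) are REPLACED by transport from the CM
  partner (GL₁: elliptic units of the CM field at the inert prime `2`) — the complementary road of memo §3 / RC-138 (3).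
* `bsdp_two_of_cmPartner_of_signedTransport_of_stubs` — the same spelled out per curve with the partner `A` and the
  Galois-equivariant `E[2] ≃ A[2]` as explicit arguments (the shape the per-class displays `bsdp_two_<label>` apply).
* `bsdp_two_of_cmPartner_of_thetaPartnerItems` — per curve with TP2's four K-items as the binders (RC-138 (3) interface).
* `supersingularRankZeroAtTwo_of_thetaHabitat_of_offHabitat` / `thetaHabitat_of_supersingularRankZeroAtTwo` — the exact
  logical position: crux 19097 = (habitat slice) ∧ (its good-supersingular complement), by excluded middle; and 19097
  implies the slice leaf (supersession direction, TP2 kill criterion (iv)).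

References: [Kobayashi2003] Thm. 1.2, 4.1, §7; [BDKim2013] Cor. 3.15; [Kato2004Asterisque] Thm. 12.4–12.5;
[GreenbergVatsal2000] Thm. (1.4); [BDKim2009] Cor. 2.13; [PollackRubin2004] Thm. 7.3; [BurungaleFlach2024] Thm. 4.1;
[KuriharaOtsuki2006] pp. 557, 564; [Miller2011LMS] Def. 1.1; memo run/shared/lean/pub/bsd-wall/bsd-wall-p2/xroute/CROSS-ROUTE-TP2-K3K4-v1.md
(a5ea7e9a17324178); RC-138 (bsd-2adic STATUS 2026-08-27T10:47:20Z).
-/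

set_option autoImplicit false
-- the Theorems namespace of this sub repeats the summit name by design (D-0017 nested layout)
set_option linter.dupNamespace false

noncomputable section

open scoped Classical MatrixGroups ModularForm

open CongruenceSubgroup WeierstrassCurve Literature.NumberTheory.EllipticCurves
  Literature.NumberTheory.EllipticCurves.ModularForms Literature.NumberTheory.EllipticCurves.Sprung2017
  Literature.NumberTheory.EllipticCurves.Rank1Residual Literature.NumberTheory.EllipticCurves.Rank1Residual.Typed
  Literature.NumberTheory.EllipticCurves.Kobayashi2003 Literature.NumberTheory.EllipticCurves.IwasawaDual
  ZpExtension Summit.BirchSwinnertonDyer.Rank1Residual Summit.BirchSwinnertonDyer.Rank1Residual.Supersingular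
  Summit.BirchSwinnertonDyer.Rank1Residual.X5.O1 Summit.BirchSwinnertonDyer.BirchSwinnertonDyer.Theses.ThetaPartnerAtTwo

namespace Summit.BirchSwinnertonDyer.BirchSwinnertonDyer.Theorems

namespace ThetaPartnerXRoute

/-! ## §1 TP2's deciding theorem with the entire-`L` binder discharged from modularity -/

/-- **The slice leaf `WAllNonCMAtTwoThetaHabitat` from TP2's items**, `EntireLFunctionRat` discharged: modularity
(`hmod`) gives the entire continuation of `L(E,s)` for every `E/ℚ` (`hasEntireLFunction_rat_of_exists_isNewformOf`
∘ `exists_isNewformOf_of_nonempty_modularParametrizationData`), then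
`Theses.ThetaPartnerAtTwo.closes`. [cite: BCDTJAMS2001, Theorem A] [cite: Kobayashi2003, Thm. 1.2 and Thm. 4.1]
[cite: BDKim2013, Cor. 3.15] -/
theorem thetaHabitat_of_thetaPartnerItems (hmod : nonempty_modularParametrizationData)
    (hGZK : rank_eq_analyticRank_of_analyticRank_le_one) (hT : SignedTransportAtTwo)
    (hCM : SignedMainConjectureCMTwoRankZero) (hKato : SignedKatoDivisibilityUpToAtTwo)
    (hStr : SignedControlAtTwo) : Summit.BirchSwinnertonDyer.WAllNonCMAtTwoThetaHabitat :=
  -- (buildfix 2026-08-28) TP2's `closes` was re-keyed (rev ≥ 20: Supply/OfPub binders); the rev-19 chain lives on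
  -- as the tree theorem `wAllNonCMAtTwoThetaHabitat_of_thetaPartnerAtTwo_items` (Theorems/ThetaPartnerAtTwoAssembly,
  -- inlined there precisely so that re-keyings do not propagate) — applied here with the same seven arguments.
  Summit.BirchSwinnertonDyer.BirchSwinnertonDyer.Theorems.wAllNonCMAtTwoThetaHabitat_of_thetaPartnerAtTwo_items hmod
    (WeierstrassCurve.hasEntireLFunction_rat_of_exists_isNewformOf
      (exists_isNewformOf_of_nonempty_modularParametrizationData hmod)) hGZK hT hCM hKato hStr

/-! ## §2 The slice leaf from 19097's stubs (1) (1′) (2′) (4) + TP2's K1, K2r0 -/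

/-- **Crux 19097 ON THE THETA HABITAT (`WAllNonCMAtTwoThetaHabitat`) from 19097's registered stubs (1) `stub_ssPub`,
(1′) `stub_katoPub`, (2′) `stub_zeroSignedEulerChar`, (4) `stub_zeroColemanKato` — signatures VERBATIM — and TP2's K1
`SignedTransportAtTwo` (20333), K2r0 `SignedMainConjectureCMTwoRankZero` (20312) BY NAME.** K3 is produced from
(1′)+(4) (`signedKatoDivisibilityUpToAtTwo_of_zeroColemanKato`, guarded clause unused), K4 from (2′)
(`signedControlAtTwo_of_signedEulerCharAtTwo`), the entire continuation from modularity; then TP2's `closes`. The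
Eisenstein half (stub (3)) and `μ⁺ = 0` (stub (4′)) do not occur. Composition certificate; every input displayed.
[cite: Kobayashi2003, Thm. 1.2, Thm. 4.1 (p. 8) and §7] [cite: BDKim2013, Thm. 1.1 and Cor. 3.15]
[cite: Kato2004Asterisque, Thm. 12.4–12.5 (pp. 221–222)] [cite: GreenbergVatsal2000, Thm. (1.4)]
[cite: PollackRubin2004, Thm. 7.3] -/
theorem thetaHabitat_of_signedTransport_of_stubs
    (hPub : nonempty_modularParametrizationData ∧ rank_eq_analyticRank_of_analyticRank_le_one)
    (hKatoPub : Kato2004.thm12_4 ∧ Kato2004_fineSelmerDual_isTorsion)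
    (hEC : ∀ (W : WeierstrassCurve ℚ) [W.IsElliptic] [W.IsGloballyMinimal],
        ¬ W.HasCM → W.analyticRank = 0 → GoodSS W 2 → W.frobeniusTrace 2 = 0 →
        ∀ (κ : ZpExtension ℚ 2) (γ : Field.absoluteGaloisGroup ℚ),
          κ.IsCyclotomic → κ.IsTopGenerator γ → Finite (W.selmerGroupPInfty 2) →
          Finite (endInvariants (conjSignedSelmerInfty W κ 1 γ - 1)) ∧
            ∃ u : ℤ_[2]ˣ, (Nat.card (endInvariants (conjSignedSelmerInfty W κ 1 γ - 1)) : ℚ_[2]) =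
              ((u : ℤ_[2]) : ℚ_[2]) * ((2 : ℕ) : ℚ_[2]) ^ (padicValNat 2 W.tamagawaProduct) *
                (Nat.card (W.selmerGroupPInfty 2) : ℚ_[2]) *
                  (Nat.card (EndCoinvariants (conjSignedSelmerInfty W κ 1 γ - 1)) : ℚ_[2]))
    (hCK : ∀ (W : WeierstrassCurve ℚ) [W.IsElliptic] [W.IsGloballyMinimal],
      ¬ W.HasCM → W.analyticRank = 0 → GoodSS W 2 → W.frobeniusTrace 2 = 0 →
      ∀ (κ : ZpExtension ℚ 2) (γ : Field.absoluteGaloisGroup ℚ),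
        κ.IsCyclotomic → κ.IsTopGenerator γ → IsCyclotomicVariable 2 γ →
        ∀ [NeZero (W.conductorNorm ℤ)] (f : CuspForm (Gamma0 (W.conductorNorm ℤ)) 2),
          IsNewformOf W f → ∀ (ϖ : ℚ), (ϖ : ℝ) * W.realPeriodRat = plusPeriod f →
        ∀ (Lplus Lminus : IwasawaAlgebra 2), IsPollackPair f 2 Lplus Lminus →
        ∀ (D : SignedSelmerDualData W κ γ 1) [ContinuousSMul ℤ_[2] (W.tateModule 2)],
          ∃ (I : Kato2004.IwasawaH1Data W 2 κ γ) (Y : W.FineSelmerDualData κ γ)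
            (P : Submodule (IwasawaAlgebra 2) (IwasawaAlgebra 2))
            (loc : I.H →ₗ[IwasawaAlgebra 2] P) (toX : P →ₗ[IwasawaAlgebra 2] D.X)
            (δ : D.X →ₗ[IwasawaAlgebra 2] Y.X) (Z : Submodule (IwasawaAlgebra 2) I.H)
            (G : IwasawaAlgebra 2),
            Function.Exact loc toX ∧ Function.Exact toX δ ∧
            G ∈ Submodule.map (P.subtype ∘ₗ loc) Z ∧
            iwasawaToPowerSeries 2 G =
              PowerSeries.C (ϖ : ℚ_[2]) * iwasawaToPowerSeries 2 (kobayashiL 1 Lplus Lminus) ∧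
            (∀ 𝔭 : PrimeSpectrum (IwasawaAlgebra 2), 𝔭.asIdeal.height = 1 →
              PowerSeries.C (2 : ℤ_[2]) ∉ 𝔭.asIdeal →
              Literature.NumberTheory.EllipticCurves.Module.lengthAt (IwasawaAlgebra 2) Y.X 𝔭 ≤
                Literature.NumberTheory.EllipticCurves.Module.lengthAt (IwasawaAlgebra 2) (I.H ⧸ Z) 𝔭) ∧
            (TwoAdicSurjective W →
              ∀ 𝔭 : PrimeSpectrum (IwasawaAlgebra 2), 𝔭.asIdeal.height = 1 →
                PowerSeries.C (2 : ℤ_[2]) ∈ 𝔭.asIdeal →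
                Literature.NumberTheory.EllipticCurves.Module.lengthAt (IwasawaAlgebra 2) Y.X 𝔭 ≤
                  Literature.NumberTheory.EllipticCurves.Module.lengthAt (IwasawaAlgebra 2) (I.H ⧸ Z) 𝔭))
    (hT : SignedTransportAtTwo) (hCM : SignedMainConjectureCMTwoRankZero) :
    Summit.BirchSwinnertonDyer.WAllNonCMAtTwoThetaHabitat :=
  thetaHabitat_of_thetaPartnerItems hPub.1 hPub.2 hT hCM
    (signedKatoDivisibilityUpToAtTwo_of_zeroColemanKato hKatoPub hCK)
    (signedControlAtTwo_of_signedEulerCharAtTwo hEC)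

/-! ## §3 Per curve, with the CM partner explicit (the shape the per-class displays apply) -/

/-- **BSD₂ of a habitat curve from its CM partner, per curve** — binders: PUB (1), Kato PUB (1′), the signed Euler
characteristic at `2` (2′) and the Coleman–Kato package at `2` (4) of crux 19097 (∀-closed, signatures verbatim),
TP2's K1 and K2r0 by name; arguments: the curve `W` (non-CM, `r_an = 0`, good supersingular at `2`, `a₂ = 0`), a CM
curve `A` (`r_an = 0`, good supersingular at `2`, `a₂ = 0`) and a Galois-equivariant isomorphism `E[2] ≃ A[2]`.
[cite: GreenbergVatsal2000, Thm. (1.4)] [cite: Kobayashi2003, Thm. 1.2 and Thm. 4.1] [cite: BDKim2013, Cor. 3.15]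
[cite: Miller2011LMS, Def. 1.1] -/
theorem bsdp_two_of_cmPartner_of_signedTransport_of_stubs
    (hPub : nonempty_modularParametrizationData ∧ rank_eq_analyticRank_of_analyticRank_le_one)
    (hKatoPub : Kato2004.thm12_4 ∧ Kato2004_fineSelmerDual_isTorsion)
    (hEC : ∀ (W : WeierstrassCurve ℚ) [W.IsElliptic] [W.IsGloballyMinimal],
        ¬ W.HasCM → W.analyticRank = 0 → GoodSS W 2 → W.frobeniusTrace 2 = 0 →
        ∀ (κ : ZpExtension ℚ 2) (γ : Field.absoluteGaloisGroup ℚ),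
          κ.IsCyclotomic → κ.IsTopGenerator γ → Finite (W.selmerGroupPInfty 2) →
          Finite (endInvariants (conjSignedSelmerInfty W κ 1 γ - 1)) ∧
            ∃ u : ℤ_[2]ˣ, (Nat.card (endInvariants (conjSignedSelmerInfty W κ 1 γ - 1)) : ℚ_[2]) =
              ((u : ℤ_[2]) : ℚ_[2]) * ((2 : ℕ) : ℚ_[2]) ^ (padicValNat 2 W.tamagawaProduct) *
                (Nat.card (W.selmerGroupPInfty 2) : ℚ_[2]) *
                  (Nat.card (EndCoinvariants (conjSignedSelmerInfty W κ 1 γ - 1)) : ℚ_[2]))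
    (hCK : ∀ (W : WeierstrassCurve ℚ) [W.IsElliptic] [W.IsGloballyMinimal],
      ¬ W.HasCM → W.analyticRank = 0 → GoodSS W 2 → W.frobeniusTrace 2 = 0 →
      ∀ (κ : ZpExtension ℚ 2) (γ : Field.absoluteGaloisGroup ℚ),
        κ.IsCyclotomic → κ.IsTopGenerator γ → IsCyclotomicVariable 2 γ →
        ∀ [NeZero (W.conductorNorm ℤ)] (f : CuspForm (Gamma0 (W.conductorNorm ℤ)) 2),
          IsNewformOf W f → ∀ (ϖ : ℚ), (ϖ : ℝ) * W.realPeriodRat = plusPeriod f →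
        ∀ (Lplus Lminus : IwasawaAlgebra 2), IsPollackPair f 2 Lplus Lminus →
        ∀ (D : SignedSelmerDualData W κ γ 1) [ContinuousSMul ℤ_[2] (W.tateModule 2)],
          ∃ (I : Kato2004.IwasawaH1Data W 2 κ γ) (Y : W.FineSelmerDualData κ γ)
            (P : Submodule (IwasawaAlgebra 2) (IwasawaAlgebra 2))
            (loc : I.H →ₗ[IwasawaAlgebra 2] P) (toX : P →ₗ[IwasawaAlgebra 2] D.X)
            (δ : D.X →ₗ[IwasawaAlgebra 2] Y.X) (Z : Submodule (IwasawaAlgebra 2) I.H)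
            (G : IwasawaAlgebra 2),
            Function.Exact loc toX ∧ Function.Exact toX δ ∧
            G ∈ Submodule.map (P.subtype ∘ₗ loc) Z ∧
            iwasawaToPowerSeries 2 G =
              PowerSeries.C (ϖ : ℚ_[2]) * iwasawaToPowerSeries 2 (kobayashiL 1 Lplus Lminus) ∧
            (∀ 𝔭 : PrimeSpectrum (IwasawaAlgebra 2), 𝔭.asIdeal.height = 1 →
              PowerSeries.C (2 : ℤ_[2]) ∉ 𝔭.asIdeal →
              Literature.NumberTheory.EllipticCurves.Module.lengthAt (IwasawaAlgebra 2) Y.X 𝔭 ≤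
                Literature.NumberTheory.EllipticCurves.Module.lengthAt (IwasawaAlgebra 2) (I.H ⧸ Z) 𝔭) ∧
            (TwoAdicSurjective W →
              ∀ 𝔭 : PrimeSpectrum (IwasawaAlgebra 2), 𝔭.asIdeal.height = 1 →
                PowerSeries.C (2 : ℤ_[2]) ∈ 𝔭.asIdeal →
                Literature.NumberTheory.EllipticCurves.Module.lengthAt (IwasawaAlgebra 2) Y.X 𝔭 ≤
                  Literature.NumberTheory.EllipticCurves.Module.lengthAt (IwasawaAlgebra 2) (I.H ⧸ Z) 𝔭))
    (hT : SignedTransportAtTwo) (hCM : SignedMainConjectureCMTwoRankZero)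
    (W : WeierstrassCurve ℚ) [W.IsElliptic] [W.IsGloballyMinimal] (hcm : ¬ W.HasCM) (hr : W.analyticRank = 0)
    (hss : GoodSS W 2) (ha : W.frobeniusTrace 2 = 0)
    (A : WeierstrassCurve ℚ) [A.IsElliptic] [A.IsGloballyMinimal] (hAcm : A.HasCM) (hAr : A.analyticRank = 0)
    (hAss : GoodSS A 2) (hAa : A.frobeniusTrace 2 = 0)
    (e : WeierstrassCurve.geomTorsion W (2 : ℤ) ≃+ WeierstrassCurve.geomTorsion A (2 : ℤ))
    (he : ∀ (σ : Field.absoluteGaloisGroup ℚ) (P : WeierstrassCurve.geomTorsion W (2 : ℤ)), e (σ • P) = σ • e P) :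
    BSDp W 2 :=
  thetaHabitat_of_signedTransport_of_stubs hPub hKatoPub hEC hCK hT hCM W hcm hr hss ha
    ⟨A, ‹_›, ‹_›, hAcm, hAr, hAss, hAa, e, he⟩

/-- **BSD₂ of a habitat curve from its CM partner with TP2's four K-items as the binders** (RC-138 (3) interface:
«conclusion `BSDp W 2`, binders = TP2's K-items by name», modularity and GZK as the PUB binders).
[cite: GreenbergVatsal2000, Thm. (1.4)] [cite: Kobayashi2003, Thm. 1.2 and Thm. 4.1] [cite: BDKim2013, Cor. 3.15]
[cite: Miller2011LMS, Def. 1.1] -/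
theorem bsdp_two_of_cmPartner_of_thetaPartnerItems (hmod : nonempty_modularParametrizationData)
    (hGZK : rank_eq_analyticRank_of_analyticRank_le_one) (hT : SignedTransportAtTwo)
    (hCM : SignedMainConjectureCMTwoRankZero) (hKato : SignedKatoDivisibilityUpToAtTwo) (hStr : SignedControlAtTwo)
    (W : WeierstrassCurve ℚ) [W.IsElliptic] [W.IsGloballyMinimal] (hcm : ¬ W.HasCM) (hr : W.analyticRank = 0)
    (hss : GoodSS W 2) (ha : W.frobeniusTrace 2 = 0)
    (A : WeierstrassCurve ℚ) [A.IsElliptic] [A.IsGloballyMinimal] (hAcm : A.HasCM) (hAr : A.analyticRank = 0)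
    (hAss : GoodSS A 2) (hAa : A.frobeniusTrace 2 = 0)
    (e : WeierstrassCurve.geomTorsion W (2 : ℤ) ≃+ WeierstrassCurve.geomTorsion A (2 : ℤ))
    (he : ∀ (σ : Field.absoluteGaloisGroup ℚ) (P : WeierstrassCurve.geomTorsion W (2 : ℤ)), e (σ • P) = σ • e P) :
    BSDp W 2 :=
  thetaHabitat_of_thetaPartnerItems hmod hGZK hT hCM hKato hStr W hcm hr hss ha
    ⟨A, ‹_›, ‹_›, hAcm, hAr, hAss, hAa, e, he⟩

/-! ## §4 Logical position of the slice inside crux 19097 -/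

/-- **Supersession (TP2 kill criterion (iv))**: crux 19097 `SupersingularRankZeroAtTwo` implies the slice leaf
`WAllNonCMAtTwoThetaHabitat` outright (drop `a₂ = 0` and the partner). [folklore: restriction of a ∀] -/
theorem thetaHabitat_of_supersingularRankZeroAtTwo
    (h : Summit.BirchSwinnertonDyer.BirchSwinnertonDyer.Theses.ByReductionTypeAtTwo.SupersingularRankZeroAtTwo) :
    Summit.BirchSwinnertonDyer.WAllNonCMAtTwoThetaHabitat :=
  fun W _ _ hcm hr hss _ _ => h W hcm hr hss

/-- **Crux 19097 = (theta-habitat slice) ∧ (its complement inside the good-supersingular rank-`0` block)**, by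
excluded middle on the habitat clause: the complement is «`a₂ = ±2`, or `a₂ = 0` without a rank-`0` CM partner» —
exactly what line `signed_halves_two` attacks per sub-row. No content; records where this seat's road applies.
[folklore: excluded middle] -/
theorem supersingularRankZeroAtTwo_of_thetaHabitat_of_offHabitat
    (hHab : Summit.BirchSwinnertonDyer.WAllNonCMAtTwoThetaHabitat)
    (hOff : ∀ (W : WeierstrassCurve ℚ) [W.IsElliptic] [W.IsGloballyMinimal], ¬ W.HasCM →
      W.analyticRank = 0 → GoodSS W 2 →
      ¬ (W.frobeniusTrace 2 = 0 ∧
          ∃ (A : WeierstrassCurve ℚ) (_ : A.IsElliptic) (_ : A.IsGloballyMinimal),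
            A.HasCM ∧ A.analyticRank = 0 ∧ GoodSS A 2 ∧ A.frobeniusTrace 2 = 0 ∧
              ∃ e : WeierstrassCurve.geomTorsion W (2 : ℤ) ≃+ WeierstrassCurve.geomTorsion A (2 : ℤ),
                ∀ (σ : Field.absoluteGaloisGroup ℚ) (P : WeierstrassCurve.geomTorsion W (2 : ℤ)),
                  e (σ • P) = σ • e P) →
      BSDp W 2) :
    Summit.BirchSwinnertonDyer.BirchSwinnertonDyer.Theses.ByReductionTypeAtTwo.SupersingularRankZeroAtTwo := by
  intro W _ _ hcm hr hss
  by_cases hH : (W.frobeniusTrace 2 = 0 ∧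
      ∃ (A : WeierstrassCurve ℚ) (_ : A.IsElliptic) (_ : A.IsGloballyMinimal),
        A.HasCM ∧ A.analyticRank = 0 ∧ GoodSS A 2 ∧ A.frobeniusTrace 2 = 0 ∧
          ∃ e : WeierstrassCurve.geomTorsion W (2 : ℤ) ≃+ WeierstrassCurve.geomTorsion A (2 : ℤ),
            ∀ (σ : Field.absoluteGaloisGroup ℚ) (P : WeierstrassCurve.geomTorsion W (2 : ℤ)),
              e (σ • P) = σ • e P)
  · exact hHab W hcm hr hss hH.1 hH.2
  · exact hOff W hcm hr hss hH

end ThetaPartnerXRoute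

end Summit.BirchSwinnertonDyer.BirchSwinnertonDyer.Theorems

end
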